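import Summits.Ventures.PercRepro.ThetaMultiProjStep

/-!
# (Θ_∞) on the consistently reducible instances

Dossier proofs/MINE1-theoremS.md, Addendum 75 (mine-1, gen 38). With the relative family, the
projection step and the validity transport of ThetaMultiRel.lean / ThetaMultiProjStep.lean, the
Marica–Schönheim induction for (Θ_∞) can be RUN in the kernel on every instance that reduces to
the extreme regime through label-consistent points:

* `sum_card_le_card_multiDRel_of_univ_mem`, `_of_empty_mem`, `_of_extreme_mem` — the `∅` / `U`
  regime relative to a ground set (the relative form of ThetaMultiHalves.lean's injections);
* `ConsistentlyReducible U A` — the instance is empty, or has an extreme member, or has a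
  label-consistent point `e ∈ U` at which both the projected instance and the partner instance
  are consistently reducible on `U ∖ e`;
* `sum_card_le_card_multiDRel_of_consistentlyReducible` — **(Θ_∞) holds for every valid
  consistently reducible instance**: `∑ᵢ |A i| ≤ |multiDRel U A|`;
* `conjThetaMulti_of_consistentlyReducible` — in particular the absolute conjecture
  `∑ᵢ |A i| ≤ |multiD A|` for every valid instance that is consistently reducible on `univ`.

What (Θ_∞) still needs beyond this theorem is exactly Addendum 73's Split Lemma at the
inconsistent points (and the (co)singleton regime).
-/

namespace PercRepro.MSTight

open Finset
open scoped FinsetFamily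

variable {α : Type*} [DecidableEq α] [Fintype α]
variable {ι : Type*} [DecidableEq ι] [Fintype ι]

section RelExtremes

variable {U : Finset α} {A : ι → Finset (Finset α)}

omit [Fintype α] in
/-- `x ↦ U ∖ x` is injective on subsets of `U`. -/
theorem sdiff_injective_aux {x y : Finset α} (hx : x ⊆ U) (hy : y ⊆ U) (h : U \ x = U \ y) :
    x = y := by
  calc x = U \ (U \ x) := (Finset.sdiff_sdiff_eq_self hx).symm
    _ = U \ (U \ y) := by rw [h]
    _ = y := Finset.sdiff_sdiff_eq_self hy

omit [Fintype α] [DecidableEq ι] in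
/-- In a valid instance the classes are pairwise disjoint, so the instance has `∑ᵢ |A i|` members. -/
theorem sum_card_eq_card_biUnion_of_valid (hv : MultiValidRel U A) :
    ∑ i, (A i).card = (univ.biUnion A).card :=
  (card_biUnion fun i _ j _ hij => (hv.2.2 i j hij).1).symm

omit [Fintype α] in
/-- **(Θ_∞) relative to `U` when the ground set is a member**: `x ↦ U ∖ x` on that class and
`x ↦ x` on the other classes inject the instance into `multiDRel U A`. -/
theorem sum_card_le_card_multiDRel_of_univ_mem (hv : MultiValidRel U A) {i₀ : ι}
    (h : U ∈ A i₀) : ∑ i, (A i).card ≤ (multiDRel U A).card := by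
  have hsub := hv.1
  have hcross := hv.2.2
  rw [sum_card_eq_card_biUnion_of_valid hv]
  refine card_le_card_of_injOn (fun x => if x ∈ A i₀ then U \ x else x) ?_ ?_
  · intro x hx
    have hx' : x ∈ univ.biUnion A := by simpa using hx
    rw [mem_biUnion] at hx'
    obtain ⟨i, -, hxi⟩ := hx'
    simp only [mem_coe]
    by_cases hx0 : x ∈ A i₀
    · rw [if_pos hx0]
      exact mem_multiDRel_of_mem_diffs i₀ (sdiff_mem_diffs h hx0)
    · rw [if_neg hx0]
      have hi : i₀ ≠ i := fun hh => hx0 (hh ▸ hxi)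
      have hm := inf_mem_multiDRel (U := U) hi h hxi
      rwa [inf_eq_inter, inter_eq_right.2 (hsub i x hxi)] at hm
  · intro x hx y hy hxy
    have hx' : x ∈ univ.biUnion A := by simpa using hx
    have hy' : y ∈ univ.biUnion A := by simpa using hy
    rw [mem_biUnion] at hx' hy'
    obtain ⟨i, -, hxi⟩ := hx'
    obtain ⟨j, -, hyj⟩ := hy'
    simp only at hxy
    by_cases hx0 : x ∈ A i₀ <;> by_cases hy0 : y ∈ A i₀
    · rw [if_pos hx0, if_pos hy0] at hxy
      exact sdiff_injective_aux (hsub i₀ x hx0) (hsub i₀ y hy0) hxy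
    · rw [if_pos hx0, if_neg hy0] at hxy
      exfalso
      have hj : j ≠ i₀ := fun hh => hy0 (hh ▸ hyj)
      have hyc : y ∈ complsRel U (A i₀) := mem_complsRel.2 ⟨x, hx0, hxy⟩
      exact disjoint_left.1 (hcross j i₀ hj).2 hyj hyc
    · rw [if_neg hx0, if_pos hy0] at hxy
      exfalso
      have hi : i ≠ i₀ := fun hh => hx0 (hh ▸ hxi)
      have hxc : x ∈ complsRel U (A i₀) := mem_complsRel.2 ⟨y, hy0, hxy.symm⟩
      exact disjoint_left.1 (hcross i i₀ hi).2 hxi hxc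
    · rw [if_neg hx0, if_neg hy0] at hxy
      exact hxy

omit [Fintype α] in
/-- **(Θ_∞) relative to `U` when the empty set is a member**: `x ↦ x` on that class and
`x ↦ U ∖ x` on the other classes inject the instance into `multiDRel U A`. -/
theorem sum_card_le_card_multiDRel_of_empty_mem (hv : MultiValidRel U A) {i₀ : ι}
    (h : (∅ : Finset α) ∈ A i₀) : ∑ i, (A i).card ≤ (multiDRel U A).card := by
  have hsub := hv.1
  have hcross := hv.2.2
  rw [sum_card_eq_card_biUnion_of_valid hv]
  refine card_le_card_of_injOn (fun x => if x ∈ A i₀ then x else U \ x) ?_ ?_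
  · intro x hx
    have hx' : x ∈ univ.biUnion A := by simpa using hx
    rw [mem_biUnion] at hx'
    obtain ⟨i, -, hxi⟩ := hx'
    simp only [mem_coe]
    by_cases hx0 : x ∈ A i₀
    · rw [if_pos hx0]
      have hd : x \ ∅ ∈ A i₀ \\ A i₀ := sdiff_mem_diffs hx0 h
      rw [sdiff_empty] at hd
      exact mem_multiDRel_of_mem_diffs i₀ hd
    · rw [if_neg hx0]
      have hi : i₀ ≠ i := fun hh => hx0 (hh ▸ hxi)
      have hm := sdiff_sup_mem_multiDRel (U := U) hi h hxi
      rwa [sup_eq_union, empty_union] at hm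
  · intro x hx y hy hxy
    have hx' : x ∈ univ.biUnion A := by simpa using hx
    have hy' : y ∈ univ.biUnion A := by simpa using hy
    rw [mem_biUnion] at hx' hy'
    obtain ⟨i, -, hxi⟩ := hx'
    obtain ⟨j, -, hyj⟩ := hy'
    simp only at hxy
    by_cases hx0 : x ∈ A i₀ <;> by_cases hy0 : y ∈ A i₀
    · rw [if_pos hx0, if_pos hy0] at hxy
      exact hxy
    · rw [if_pos hx0, if_neg hy0] at hxy
      exfalso
      have hj : j ≠ i₀ := fun hh => hy0 (hh ▸ hyj)
      have hyc : y ∈ complsRel U (A i₀) := by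
        refine mem_complsRel.2 ⟨x, hx0, ?_⟩
        rw [hxy, Finset.sdiff_sdiff_eq_self (hsub j y hyj)]
      exact disjoint_left.1 (hcross j i₀ hj).2 hyj hyc
    · rw [if_neg hx0, if_pos hy0] at hxy
      exfalso
      have hi : i ≠ i₀ := fun hh => hx0 (hh ▸ hxi)
      have hxc : x ∈ complsRel U (A i₀) := by
        refine mem_complsRel.2 ⟨y, hy0, ?_⟩
        rw [← hxy, Finset.sdiff_sdiff_eq_self (hsub i x hxi)]
      exact disjoint_left.1 (hcross i i₀ hi).2 hxi hxc
    · rw [if_neg hx0, if_neg hy0] at hxy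
      exact sdiff_injective_aux (hsub i x hxi) (hsub j y hyj) hxy

omit [Fintype α] in
/-- **(Θ_∞) relative to `U` holds whenever some class contains `∅` or `U`.** -/
theorem sum_card_le_card_multiDRel_of_extreme_mem (hv : MultiValidRel U A)
    (h : ∃ i, (∅ : Finset α) ∈ A i ∨ U ∈ A i) : ∑ i, (A i).card ≤ (multiDRel U A).card := by
  obtain ⟨i, hi | hi⟩ := h
  · exact sum_card_le_card_multiDRel_of_empty_mem hv hi
  · exact sum_card_le_card_multiDRel_of_univ_mem hv hi

end RelExtremes

section Reducible

/-- **Consistent reducibility**: the instance is empty, or has an extreme member (`∅` or the ground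
set), or has a label-consistent point at which the projected instance and the partner instance
are both consistently reducible on the smaller ground set. -/
inductive ConsistentlyReducible : Finset α → (ι → Finset (Finset α)) → Prop
  | empty {U : Finset α} {A : ι → Finset (Finset α)} (h : ∀ i, A i = ∅) :
      ConsistentlyReducible U A
  | extreme {U : Finset α} {A : ι → Finset (Finset α)} (i : ι)
      (h : (∅ : Finset α) ∈ A i ∨ U ∈ A i) : ConsistentlyReducible U A
  | step {U : Finset α} {A : ι → Finset (Finset α)} (e : α) (he : e ∈ U) (hc : ConsistentAt U e A)
      (hP : ConsistentlyReducible (U.erase e) (projE e A))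
      (hK : ConsistentlyReducible (U.erase e) (partE e A)) : ConsistentlyReducible U A

omit [Fintype α] in
/-- **(Θ_∞) holds for every valid consistently reducible instance** — the Marica–Schönheim
induction, run along the consistent points. -/
theorem sum_card_le_card_multiDRel_of_consistentlyReducible {U : Finset α}
    {A : ι → Finset (Finset α)} (hr : ConsistentlyReducible U A) (hv : MultiValidRel U A) :
    ∑ i, (A i).card ≤ (multiDRel U A).card := by
  induction hr with
  | @empty U' A' h =>
    have : ∑ i, (A' i).card = 0 := Finset.sum_eq_zero fun i _ => by rw [h i, card_empty]
    rw [this]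
    exact Nat.zero_le _
  | @extreme U' A' i h => exact sum_card_le_card_multiDRel_of_extreme_mem hv ⟨i, h⟩
  | @step U' A' e he hc _ _ ihP ihK =>
    exact sum_card_le_card_multiDRel_of_projE he (ihP (multiValidRel_projE hv hc))
      (ihK (multiValidRel_partE he hv))

/-- **The absolute conjecture on the consistently reducible instances**: for a valid instance
`A` on the full ground set, `∑ᵢ |A i| ≤ |multiD A|`. -/
theorem conjThetaMulti_of_consistentlyReducible {A : ι → Finset (Finset α)} (hv : MultiValid A)
    (hr : ConsistentlyReducible (univ : Finset α) A) : ∑ i, (A i).card ≤ (multiD A).card := by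
  rw [← multiDRel_univ]
  exact sum_card_le_card_multiDRel_of_consistentlyReducible hr ((multiValidRel_univ A).2 hv)

end Reducible

end PercRepro.MSTight
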